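import Summits.Ventures.PercRepro.S1RankTwoSetsIncidence

/-!
# PercRepro — THE SHAPE `(rank 3 on 7) ⊕ (rank 4 on 6)` OF THE `(7, 6)` CELL (p2, gen 28; SUBCLAIM-S1 §6.10
(xvii)(o); the `(7, 6)` capstone is `S1SevenSixSeparators`)

`M` coloop-free of rank `3` on `7` points (a corank-`4` part), `N` coloop-free of rank `4` on `6` points, all pairs
of rank `2`. With `t, q₄, q₅` the rank-`2` sets of `M` with `3, 4, 5` points: `N_M(3, 2) ≤ 21 + t + q₄`,
`N_M(3, 3) ≤ 70 − t`, so `#U ≤ 15 (21 + t + q₄) + 6 (70 − t)`; `f_M(2) ≤ 21 + t + q₄ + q₅`, `f_M(2) + f_M(3) = 120`,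
and `#Y ≥ 49 + 22 f_M(2) + 30 f_M(3)`; the general incidence count gives `t ≤ 21`, `q₄ ≤ 10`, `q₅ ≤ 2` (the
closure of a pair has `≤ 5` points): `Φ(7, 4) · #U ≤ 2058 + 25.2 t + 42 q₄ ≤ 3481 − 8 (t + q₄ + q₅) ≤ #Y`.
Nothing is claimed about any cell.

* `ncard_rankSet_two_le_rank_three_seven`, `ncard_profileSet_three_two_le_rank_three_seven`,
  `ncard_profileSet_three_three_le_rank_three_seven`;
* `c025_seven_four_disjointSum_three_seven_four_six`.
Axioms: standard.
-/

open scoped Matroid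

namespace PercRepro

namespace S1

open Set

variable {α : Type}

section RankThreeOnSeven

variable {M : Matroid α} [M.Finite]

/-- In a coloop-free matroid of rank `3` on `7` points, a rank-`2` set has at most `5` points. -/
theorem ncard_le_five_of_eRk_two_rank_three_seven (hM : M.eRank = ((3 : ℕ) : ℕ∞)) (hE : M.E.ncard = 7)
    (hcol : M.coloops = ∅) {X : Set α} (hX : X ⊆ M.E) (h2 : M.eRk X = ((2 : ℕ) : ℕ∞)) : X.ncard ≤ 5 := by
  have h := sub_add_one_le_ncard_ground_sdiff_of_coloops M hM hcol hX h2 (by norm_num)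
  rw [ncard_sdiff' hX M.ground_finite, hE] at h
  have := ncard_le_ncard hX M.ground_finite
  rw [hE] at this
  omega

/-- `f(2) ≤ 21 + t + q₄ + q₅`. -/
theorem ncard_rankSet_two_le_rank_three_seven (hM : M.eRank = ((3 : ℕ) : ℕ∞)) (hE : M.E.ncard = 7)
    (hcol : M.coloops = ∅) :
    (rankSet M 2).ncard ≤ 21 + (rankTwoSets M 3).ncard + (rankTwoSets M 4).ncard + (rankTwoSets M 5).ncard := by
  have hf2 : {A : Set α | A ⊆ M.E ∧ A.ncard = 2}.Finite := M.ground_finite.finite_subsets.subset (fun _ hA => hA.1)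
  have hsub : rankSet M 2 ⊆ {A : Set α | A ⊆ M.E ∧ A.ncard = 2} ∪ rankTwoSets M 3 ∪ rankTwoSets M 4 ∪
      rankTwoSets M 5 := by
    rintro A ⟨hAE, hA2⟩
    have hAfin : A.Finite := M.ground_finite.subset hAE
    have hlo : 2 ≤ A.ncard := by
      have := M.eRk_le_encard A
      rw [hA2, ← hAfin.cast_ncard_eq] at this
      exact_mod_cast this
    have hhi := ncard_le_five_of_eRk_two_rank_three_seven hM hE hcol hAE hA2
    rcases Nat.lt_or_ge A.ncard 3 with h | h
    · left; left; left; exact ⟨hAE, by omega⟩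
    rcases Nat.lt_or_ge A.ncard 4 with h' | h'
    · left; left; right; exact ⟨hAE, by omega, hA2⟩
    rcases Nat.lt_or_ge A.ncard 5 with h'' | h''
    · left; right; exact ⟨hAE, by omega, hA2⟩
    · right; exact ⟨hAE, by omega, hA2⟩
  have h := ncard_le_ncard hsub (((hf2.union (rankTwoSets_finite M 3)).union (rankTwoSets_finite M 4)).union
    (rankTwoSets_finite M 5))
  refine h.trans ((ncard_union_le _ _).trans ?_)
  refine (Nat.add_le_add_right ((ncard_union_le _ _).trans (Nat.add_le_add_right (ncard_union_le _ _) _)) _).trans ?_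
  rw [ncard_setOf_subset_ncard_eq M.ground_finite 2, hE, show Nat.choose 7 2 = 21 by decide]

/-- `N_M(3, 2) ≤ 21 + t + q₄`: the complement is a rank-`2` set with `2`, `3` or `4` points. -/
theorem ncard_profileSet_three_two_le_rank_three_seven (hE : M.E.ncard = 7) :
    (profileSet M 3 2).ncard ≤ 21 + (rankTwoSets M 3).ncard + (rankTwoSets M 4).ncard := by
  have hf2 : {A : Set α | A ⊆ M.E ∧ A.ncard = 2}.Finite := M.ground_finite.finite_subsets.subset (fun _ hA => hA.1)
  have hsub : (fun A => M.E \ A) '' profileSet M 3 2 ⊆ {A : Set α | A ⊆ M.E ∧ A.ncard = 2} ∪ rankTwoSets M 3 ∪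
      rankTwoSets M 4 := by
    rintro B ⟨A, ⟨hAE, hA3, hAc⟩, rfl⟩
    have hAfin : A.Finite := M.ground_finite.subset hAE
    have h1 : ((3 : ℕ) : ℕ∞) ≤ (A.ncard : ℕ∞) := by
      rw [← hA3, hAfin.cast_ncard_eq]; exact M.eRk_le_encard A
    have h2 : ((2 : ℕ) : ℕ∞) ≤ ((M.E \ A).ncard : ℕ∞) := by
      rw [← hAc, (M.ground_finite.subset sdiff_subset).cast_ncard_eq]; exact M.eRk_le_encard _
    have h3 : A.ncard + (M.E \ A).ncard = M.E.ncard := by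
      rw [← ncard_union_eq disjoint_sdiff_right hAfin (M.ground_finite.subset sdiff_subset), union_sdiff_cancel hAE]
    have h1' : 3 ≤ A.ncard := by exact_mod_cast h1
    have h2' : 2 ≤ (M.E \ A).ncard := by exact_mod_cast h2
    rcases Nat.lt_or_ge (M.E \ A).ncard 3 with h | h
    · left; left; exact ⟨sdiff_subset, by show (M.E \ A).ncard = 2; omega⟩
    rcases Nat.lt_or_ge (M.E \ A).ncard 4 with h' | h'
    · left; right; exact ⟨sdiff_subset, by show (M.E \ A).ncard = 3; omega, hAc⟩
    · right; exact ⟨sdiff_subset, by show (M.E \ A).ncard = 4; omega, hAc⟩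
  have hinj : InjOn (fun A => M.E \ A) (profileSet M 3 2) := by
    intro A hA A' hA' hAA
    have e : M.E \ A = M.E \ A' := hAA
    have := congrArg (fun S => M.E \ S) e
    simp only [sdiff_sdiff_cancel_left hA.1, sdiff_sdiff_cancel_left hA'.1] at this
    exact this
  have h := ncard_le_ncard hsub ((hf2.union (rankTwoSets_finite M 3)).union (rankTwoSets_finite M 4))
  rw [hinj.ncard_image] at h
  refine h.trans ((ncard_union_le _ _).trans ?_)
  refine (Nat.add_le_add_right (ncard_union_le _ _) _).trans ?_
  rw [ncard_setOf_subset_ncard_eq M.ground_finite 2, hE, show Nat.choose 7 2 = 21 by decide]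

/-- `N_M(3, 3) + t ≤ 70`: a spanning set with a rank-`3` complement has `3` points (and rank `3`) or `4` points. -/
theorem ncard_profileSet_three_three_le_rank_three_seven (hE : M.E.ncard = 7) :
    (profileSet M 3 3).ncard + (rankTwoSets M 3).ncard ≤ 70 := by
  have hf : ∀ k : ℕ, {A : Set α | A ⊆ M.E ∧ A.ncard = k}.Finite := fun k =>
    M.ground_finite.finite_subsets.subset (fun _ hA => hA.1)
  have hTsub : rankTwoSets M 3 ⊆ {A : Set α | A ⊆ M.E ∧ A.ncard = 3} := fun T hT => ⟨hT.1, hT.2.1⟩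
  have hsub : profileSet M 3 3 ⊆ ({A : Set α | A ⊆ M.E ∧ A.ncard = 3} \ rankTwoSets M 3) ∪
      {A : Set α | A ⊆ M.E ∧ A.ncard = 4} := by
    rintro A ⟨hAE, hA3, hAc⟩
    have hAfin : A.Finite := M.ground_finite.subset hAE
    have h1 : ((3 : ℕ) : ℕ∞) ≤ (A.ncard : ℕ∞) := by
      rw [← hA3, hAfin.cast_ncard_eq]; exact M.eRk_le_encard A
    have h2 : ((3 : ℕ) : ℕ∞) ≤ ((M.E \ A).ncard : ℕ∞) := by
      rw [← hAc, (M.ground_finite.subset sdiff_subset).cast_ncard_eq]; exact M.eRk_le_encard _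
    have h3 : A.ncard + (M.E \ A).ncard = M.E.ncard := by
      rw [← ncard_union_eq disjoint_sdiff_right hAfin (M.ground_finite.subset sdiff_subset), union_sdiff_cancel hAE]
    have h1' : 3 ≤ A.ncard := by exact_mod_cast h1
    have h2' : 3 ≤ (M.E \ A).ncard := by exact_mod_cast h2
    rcases Nat.lt_or_ge A.ncard 4 with h | h
    · left
      refine ⟨⟨hAE, by omega⟩, fun hT => ?_⟩
      have := hT.2.2
      rw [hA3] at this
      exact absurd this (by decide)
    · right; exact ⟨hAE, by omega⟩
  have h := ncard_le_ncard hsub (((hf 3).subset sdiff_subset).union (hf 4))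
  rw [ncard_union_eq (by rw [Set.disjoint_left]; rintro A ⟨⟨-, h3⟩, -⟩ ⟨-, h4⟩; omega)
    ((hf 3).subset sdiff_subset) (hf 4), ncard_sdiff hTsub (rankTwoSets_finite M 3),
    ncard_setOf_subset_ncard_eq M.ground_finite 3, ncard_setOf_subset_ncard_eq M.ground_finite 4, hE,
    show Nat.choose 7 3 = 35 by decide, show Nat.choose 7 4 = 35 by decide] at h
  have hT : (rankTwoSets M 3).ncard ≤ 35 := by
    have := ncard_le_ncard hTsub (hf 3)
    rwa [ncard_setOf_subset_ncard_eq M.ground_finite 3, hE, show Nat.choose 7 3 = 35 by decide] at this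
  omega

end RankThreeOnSeven

/-- The arithmetic of the shape `(rank 3 on 7) ⊕ (rank 4 on 6)` at `(7, 4)`. -/
theorem consumer_arith_three_seven_four_six {u y t q4 q5 F2 F3 : ℚ}
    (hU : u ≤ 15 * (21 + t + q4) + 6 * (70 - t)) (hY : 49 + 22 * F2 + 30 * F3 ≤ y) (h23 : 120 ≤ F2 + F3)
    (hF2 : F2 ≤ 21 + t + q4 + q5) (ht : 3 * t ≤ 3 * 21) (hq4 : 6 * q4 ≤ 3 * 21) (hq5 : 10 * q5 ≤ 1 * 21) :
    14 / 5 * u ≤ y := by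
  linarith

/-- **`M ⊕ N` at `(7, 4)`**: `M` coloop-free of rank `3` on `7` points and `N` coloop-free of rank `4` on `6` points,
both with all pairs of rank `2` — the shape `(rank 3 on 7) ⊕ (rank 4 on 6)` of the `(7, 6)` cell. -/
theorem c025_seven_four_disjointSum_three_seven_four_six (M N : Matroid α) [M.Finite] [N.Finite]
    (h : Disjoint M.E N.E) (hM : M.eRank = ((3 : ℕ) : ℕ∞)) (hME : M.E.ncard = 7) (hcolM : M.coloops = ∅)
    (hpairsM : ∀ e ∈ M.E, ∀ f ∈ M.E, e ≠ f → M.eRk {e, f} = 2) (hN : N.eRank = ((4 : ℕ) : ℕ∞))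
    (hNE : N.E.ncard = 6) (hcolN : N.coloops = ∅) (hpairsN : ∀ e ∈ N.E, ∀ f ∈ N.E, e ≠ f → N.eRk {e, f} = 2) :
    phiK 7 4 * ({A : Set α | A ⊆ (M.disjointSum N h).E ∧ (M.disjointSum N h).eRk A = ((7 : ℕ) : ℕ∞) ∧
        (M.disjointSum N h).eRk ((M.disjointSum N h).E \ A) = ((4 : ℕ) : ℕ∞)}.ncard : ℚ) ≤
      ({A : Set α | A ⊆ (M.disjointSum N h).E ∧ ((4 : ℕ) : ℕ∞) < (M.disjointSum N h).eRk A ∧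
        (M.disjointSum N h).eRk A < ((7 : ℕ) : ℕ∞)}.ncard : ℚ) := by
  have h32 := ncard_profileSet_three_two_le_rank_three_seven (M := M) hME
  have h33 := ncard_profileSet_three_three_le_rank_three_seven (M := M) hME
  -- the `U`-side: the slices `(3, 2)` and `(3, 3)`
  have hU : {A : Set α | A ⊆ (M.disjointSum N h).E ∧ (M.disjointSum N h).eRk A = ((7 : ℕ) : ℕ∞) ∧
      (M.disjointSum N h).eRk ((M.disjointSum N h).E \ A) = ((4 : ℕ) : ℕ∞)}.ncard ≤
      15 * (21 + (rankTwoSets M 3).ncard + (rankTwoSets M 4).ncard) + 6 * (70 - (rankTwoSets M 3).ncard) := by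
    rw [disjointSum_ncard_U_eq_finsum M N h 7 4, finsum_mem_coe_finset]
    rw [Finset.sum_eq_add_of_mem (3, 2) (3, 3) (by decide) (by decide) (by decide) ?_]
    · dsimp only
      show (profileSet M 3 2).ncard * (profileSet N 4 2).ncard + (profileSet M 3 3).ncard * (profileSet N 4 1).ncard ≤ _
      have g42 := ncard_profileSet_le_choose_of_ncard_eq (N := N) (a := 4) (b := 2) hNE
      rw [show Nat.choose (4 + 2) 4 = 15 by decide] at g42
      have g41 := ncard_profileSet_top_one_le_of_pairs' hpairsN 4
      rw [hNE] at g41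
      have e1 := Nat.mul_le_mul h32 g42
      have e2 := Nat.mul_le_mul (show (profileSet M 3 3).ncard ≤ 70 - (rankTwoSets M 3).ncard by omega) g41
      omega
    · rintro ⟨a, b⟩ hmem ⟨hne1, hne2⟩
      rw [Finset.mem_product, Finset.mem_range, Finset.mem_range] at hmem
      dsimp only
      rcases Nat.lt_or_ge 3 a with ha | ha
      · rw [profileSet_eq_empty_of_eRank_lt M hM ha b, ncard_empty, zero_mul]
      rcases Nat.lt_or_ge a 3 with ha' | ha'
      · have h7a : 4 < 7 - a := by omega
        rw [profileSet_eq_empty_of_eRank_lt N hN h7a (4 - b), ncard_empty, mul_zero]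
      have ha3 : a = 3 := by omega
      subst ha3
      rw [show (7 : ℕ) - 3 = 4 from rfl]
      rcases Nat.lt_or_ge b 2 with hb | hb
      · have h6 : N.E.ncard < 4 + (4 - b) := by rw [hNE]; omega
        rw [profileSet_eq_empty_of_ncard_lt N h6, ncard_empty, mul_zero]
      · have hb4 : b = 4 := by
          rcases Nat.lt_or_ge b 4 with hb4 | hb4
          · exfalso
            rcases Nat.lt_or_ge b 3 with hb3 | hb3
            · exact hne1 (by congr 1; omega)
            · exact hne2 (by congr 1; omega)
          · omega
        subst hb4
        rw [profileSet_eq_empty_of_eRank_lt_snd M hM (by norm_num) 3, ncard_empty, zero_mul]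
  -- the `Y`-side
  have hY : 49 + 22 * (rankSet M 2).ncard + 30 * (rankSet M 3).ncard ≤
      {A : Set α | A ⊆ (M.disjointSum N h).E ∧ ((4 : ℕ) : ℕ∞) < (M.disjointSum N h).eRk A ∧
        (M.disjointSum N h).eRk A < ((7 : ℕ) : ℕ∞)}.ncard := by
    rw [disjointSum_ncard_Y_eq_finsum M N h 7 4, finsum_mem_coe_finset]
    have hsub : ({(1, 4), (2, 3), (2, 4), (3, 2), (3, 3)} : Finset (ℕ × ℕ)) ⊆
        (Finset.range 7 ×ˢ Finset.range 7).filter (fun x : ℕ × ℕ => 4 < x.1 + x.2 ∧ x.1 + x.2 < 7) := by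
      decide
    refine le_trans ?_ (Finset.sum_le_sum_of_subset hsub)
    rw [Finset.sum_insert (by decide), Finset.sum_insert (by decide), Finset.sum_insert (by decide),
      Finset.sum_insert (by decide), Finset.sum_singleton]
    dsimp only
    have F1 : 7 ≤ (rankSet M 1).ncard := by
      have := ncard_le_ncard_rankSet_one_of_pairs hpairsM (by omega)
      rwa [hME] at this
    have G2 : 15 ≤ (rankSet N 2).ncard := by
      have := choose_le_ncard_rankSet_two_of_pairs hpairsN
      rwa [hNE, show Nat.choose 6 2 = 15 by decide] at this
    have G3 := ncard_rankSet_three_ge_rank_four_six N hN hNE hcolN hpairsN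
    have G4 : 7 ≤ (rankSet N 4).ncard := by
      have := succ_le_ncard_rankSet_top_of_coloops N hN hcolN
      rwa [hNE] at this
    have e14 := Nat.mul_le_mul F1 G4
    have e23 := Nat.mul_le_mul_left (rankSet M 2).ncard G3
    have e24 := Nat.mul_le_mul_left (rankSet M 2).ncard G4
    have e32 := Nat.mul_le_mul_left (rankSet M 3).ncard G2
    have e33 := Nat.mul_le_mul_left (rankSet M 3).ncard G3
    linarith
  -- the profile of `M` and the incidence counts
  have h23 := ncard_rankSet_two_add_three_ge_of_pairs hM hpairsM
  rw [hME, show 2 ^ 7 - 1 - 7 = 120 by decide] at h23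
  have hF2 := ncard_rankSet_two_le_rank_three_seven hM hME hcolM
  have hcl : ∀ x ∈ M.E, ∀ y ∈ M.E, x ≠ y → (M.closure {x, y}).ncard ≤ 3 + 2 := by
    intro x hx y hy hxy
    have := ncard_closure_pair_le_of_coloops' M hM (by norm_num) hcolM hpairsM hx hy hxy
    rw [hME] at this
    omega
  have ht := choose_mul_ncard_rankTwoSets_le M hpairsM (c := 3) (m := 3) hcl
  have hq4 := choose_mul_ncard_rankTwoSets_le M hpairsM (c := 3) (m := 4) hcl
  have hq5 := choose_mul_ncard_rankTwoSets_le M hpairsM (c := 3) (m := 5) hcl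
  rw [hME, show Nat.choose 3 2 = 3 by decide, show Nat.choose 3 (3 - 2) = 3 by decide,
    show Nat.choose 7 2 = 21 by decide] at ht
  rw [hME, show Nat.choose 4 2 = 6 by decide, show Nat.choose 3 (4 - 2) = 3 by decide,
    show Nat.choose 7 2 = 21 by decide] at hq4
  rw [hME, show Nat.choose 5 2 = 10 by decide, show Nat.choose 3 (5 - 2) = 1 by decide,
    show Nat.choose 7 2 = 21 by decide] at hq5
  rw [phiK_seven_four]
  have ht35 : (rankTwoSets M 3).ncard ≤ 70 := by omega
  have hU' : (({A : Set α | A ⊆ (M.disjointSum N h).E ∧ (M.disjointSum N h).eRk A = ((7 : ℕ) : ℕ∞) ∧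
      (M.disjointSum N h).eRk ((M.disjointSum N h).E \ A) = ((4 : ℕ) : ℕ∞)}.ncard : ℕ) : ℚ) ≤
      15 * (21 + ((rankTwoSets M 3).ncard : ℚ) + ((rankTwoSets M 4).ncard : ℚ)) +
        6 * (70 - ((rankTwoSets M 3).ncard : ℚ)) := by
    have hcast : ((15 * (21 + (rankTwoSets M 3).ncard + (rankTwoSets M 4).ncard) +
        6 * (70 - (rankTwoSets M 3).ncard) : ℕ) : ℚ) =
        15 * (21 + ((rankTwoSets M 3).ncard : ℚ) + ((rankTwoSets M 4).ncard : ℚ)) +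
          6 * (70 - ((rankTwoSets M 3).ncard : ℚ)) := by
      push_cast [Nat.cast_sub ht35]
      ring
    rw [← hcast]
    exact_mod_cast hU
  have hY' : 49 + 22 * ((rankSet M 2).ncard : ℚ) + 30 * ((rankSet M 3).ncard : ℚ) ≤
      (({A : Set α | A ⊆ (M.disjointSum N h).E ∧ ((4 : ℕ) : ℕ∞) < (M.disjointSum N h).eRk A ∧
        (M.disjointSum N h).eRk A < ((7 : ℕ) : ℕ∞)}.ncard : ℕ) : ℚ) := by
    exact_mod_cast hY
  exact consumer_arith_three_seven_four_six (q5 := (((rankTwoSets M 5).ncard : ℕ) : ℚ)) hU' hY'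
    (by exact_mod_cast h23) (by exact_mod_cast hF2) (by exact_mod_cast ht) (by exact_mod_cast hq4)
    (by exact_mod_cast hq5)

end S1

end PercRepro
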